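import Summits.HodgeConjecture.HodgeConjecture.Theorems.MarkmanPartnerTransportPicardThreeK3SquaresKugaSatakeResidue
import Summits.HodgeConjecture.HodgeConjecture.Theorems.MarkmanPartnerTransportPicardThreeK3SquaresAlgebraicLocusSpread
import Literature.AlgebraicGeometry.HodgeTheory.BlochSemiregularSpread
import Literature.AlgebraicGeometry.HodgeTheory.AlgebraicClassesPullback

/-!
# Route MarkmanPartnerTransport · crux `PicardThreeK3Squares` (stmt-HodgeConjecture-19652) — «K3-SR»: the
# SEMIREGULAR-SEED entry of the spread chain on `S × S` (K3-square twin of T3A `OrphanSR`), and the residue of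
# the crux re-stated with semiregular seeds as the one geometric input at `ρ(S) ∈ {4, 6, 7, 10, 13}`

Planner p1 g39 (ASSIGNMENT (B) «K3-SR», 2026-08-28T15:36:33Z), prover seat hodge-nonav-19716-p2 (gen 7).
`…PicardThreeK3SquaresAlgebraicLocusSpread` (gen 7 of seat 19652-p1) proves the SPREADING step
(`algebraicLocusClosed`: Charles–Schnell + Baire, fact-free) and the reductions
`hodgeConjectureFor_square_of_spreadFamily ∕ _of_dominantFamily`, whose one geometric input is a family through
`S × S` carrying the generator class and ALGEBRAIC ON A NON-EMPTY OPEN SET of the base. The X-side file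
`…OrphanSR` (T3A `kappaClass_mem_algebraicClasses_of_semiregularSeed`) produces such an open set from ONE
Bloch-semiregular seed (`BlochSemiregularSpread 4 2`: Bloch 1972 Thm. 7.3 ∕ Buchweitz–Flenner 2003 Thm. 5.2).
This file is the K3-square twin — the semiregular-seed ENTRY of the `S × S` chain, with the seed binder kept
VERBATIM T3A's (so a future geometric seed instantiates it with no glue):

* `mem_algebraicClasses_of_semiregularSeed` — for a smooth projective surface `S` with `S ⊗ S ≅ 𝒳_{t₁}` a fibre
  of a smooth projective family of FOURFOLDS `f : 𝒳 → B` (quasi-projective total space, smooth quasi-projective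
  base, `B(ℂ)` connected) carrying a global class `W ∈ H⁴(𝒳(ℂ); ℂ)` fibrewise rational of type `(2,2)`, whose
  value at `s₀` is supported on an integral Bloch-semiregular lci surface `Z ⊂ X₀ ≅ 𝒳_{s₀}`: every class
  `γ ∈ H⁴((S ⊗ S)(ℂ); ℂ)` with `e₁^* W|_{𝒳_{t₁}} ≡ γ (mod A²(S ⊗ S))` is ALGEBRAIC (Bloch spread near `s₀` →
  `algebraicLocusClosed` → transport along `e₁`);
* `isCycleInducedTranscendentalEndomorphism_of_semiregularSeed` — hence a rational, type-preserving endomorphism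
  `t` of `H²(S(ℂ); ℂ)` killing `N¹(S)` with image `⊥ N¹(S)` and `t = [γ]_*` for such a `γ` is CYCLE-INDUCED
  (`Literature.….IsCycleInducedTranscendentalEndomorphism`);
* `hodgeConjectureFor_square_of_semiregularSeed` — and if `t` generates the rational Hodge endomorphisms of
  `T(S)` (`TranscendentalEndomorphismsGeneratedBy S t`), **HC⁴(S ⊗ S)** (rung F4 `SquareOfGenerator.squareOfGenerator`);
* `genCycle_of_semiregularSeed`, `irrCycle_of_semiregularSeed`, and
  **`picardThreeK3Squares_of_kugaSatake_of_semiregularSeeds` — the crux BY NAME from {Buskin, markings,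
  Varesco 2023 Thm. 5.3, Kuga–Satake on the real-quadratic surfaces `3 ≤ ρ ≤ 16`} (exactly as in
  `picardThreeK3Squares_of_kugaSatake_of_generation_and_oneCycle`, p640321) plus, at `ρ(S) ∈ {4, 6, 10}`, a
  GENERATING rational Hodge endomorphism `e = [γ]_*` with a semiregular seed for `γ`, and at `ρ(S) ∈ {7, 13}` one
  such `e` with an irrational `(2,0)`-eigenvalue and a semiregular seed for `γ`** — the typed SOCKET the chapter
  «algebraic source for RM classes of degree `≥ 3`» (memo ROUTE-P1AL) plugs into on the K3 side (the X-side
  socket is the 20241 seat's `CellSeed`).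

CONDITIONAL on the EXISTENCE of the seed packages (open: no printed semiregular surface detecting a
real-multiplication class of degree `≥ 3` on a K3 square) and on the named facts displayed
{`BlochSemiregularSpread 4 2`; for the socket also Buskin, `Huybrechts_K3_marking_exists`, Varesco, KSHC};
no definition, no sorry, no new named fact; nothing here proves the crux or the Hodge conjecture; rung F-H1 is
not moved. `--supports stmt-HodgeConjecture-19652`.

References: S. Bloch, Invent. Math. 17 (1972) Thm. 7.3; R.-O. Buchweitz, H. Flenner, Compositio Math. 137 (2003)
Thm. 5.2; F. Charles, C. Schnell, *Notes on absolute Hodge classes* (2014) Prop. 11.3.11; C. Voisin, *Hodge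
Theory II*, §7.3.2; B. van Geemen, M. Schütt, Forum Math. Sigma 13 (2025) e2, §4.8; M. Varesco, Math. Z. 305
(2023) §2.
-/

set_option linter.dupNamespace false

noncomputable section

namespace Summit.HodgeConjecture.HodgeConjecture.Theorems.MarkmanPartnerTransport.SemiregularSeed

open Module CategoryTheory MonoidalCategory CartesianMonoidalCategory AlgebraicGeometry
open Literature.AlgebraicGeometry Literature.AlgebraicGeometry.Motives Literature.AlgebraicGeometry.HodgeTheory
open Literature.AlgebraicGeometry.Hyperkaehler Literature.AlgebraicGeometry.Surfaces
open Literature.AlgebraicTopology.SingularHomology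
open Summit.HodgeConjecture.HodgeConjecture.Theorems
open Summit.HodgeConjecture.HodgeConjecture.Theorems.NikulinTwinTransport
open Summit.HodgeConjecture.HodgeConjecture.Theorems.MarkmanPartnerTransport
open Summit.HodgeConjecture.HodgeConjecture.Theorems.MarkmanPartnerTransport.AlgebraicLocusSpread
open Summit.HodgeConjecture.HodgeConjecture.Theorems.MarkmanPartnerTransport.KugaSatakeSimilitude
open Summit.HodgeConjecture.HodgeConjecture.Theses.MarkmanPartnerTransport

variable {S : SchemeOver ℂ}

/-- `Corr[hS ; γ, y] = fst_*(snd^* y ∪ γ)` on `H²(S(ℂ); ℂ)`, complex orientations (VERBATIM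
`…AlgebraicLocusSpread`). Local notation only. -/
local notation3 (prettyPrint := false) "Corr[" hS " ; " γ ", " y "]" =>
  complexGysin complexOrientationFamily (IsSmoothProjective.tensor_holds hS hS) hS
    (SemiCartesianMonoidalCategory.fst _ _) (rfl : 2 * 1 + 2 * 2 + 2 * 2 = 2 * 1 + 2 * (2 + 2))
    (cupProduct (rfl : 2 * 1 + 2 * 2 = 2 * 1 + 2 * 2)
      (complexBetti.map (SemiCartesianMonoidalCategory.snd _ _) (2 * 1) y) γ)

/-- `Res[f, s, k, A] = A|_{𝒳_s}`, restriction of a global class to the fibre over `s` (VERBATIM `…OrphanSR`).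
Local notation only. -/
local notation3 (prettyPrint := false) "Res[" f ", " s ", " k ", " A "]" =>
  complexBetti.map (Motives.fiberι f s) k A

/-- `SRSeed[S ; γ]`: a SEMIREGULAR SEED PACKAGE for the class `γ ∈ H⁴((S ⊗ S)(ℂ); ℂ)` — VERBATIM the seed
binders of T3A `OrphanSR.kappaClass_mem_algebraicClasses_of_semiregularSeed` with `X ↦ S ⊗ S` and
`κ_θ ↦ γ`: a smooth projective family of fourfolds `f : 𝒳 → B` (quasi-projective total space, smooth
quasi-projective base, `B(ℂ)` connected), `e₁ : S ⊗ S ≅ 𝒳_{t₁}`, a global class `W ∈ H⁴(𝒳(ℂ); ℂ)` fibrewise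
rational of type `(2,2)` with `e₁^* W|_{𝒳_{t₁}} ≡ γ (mod A²(S ⊗ S))`, and at `s₀` the fibre value `e₀^* W|_{𝒳_{s₀}}`
supported on an integral Bloch-semiregular local complete intersection surface `Z ⊂ X₀ ≅ 𝒳_{s₀}`. Local
notation only. -/
local notation3 (prettyPrint := false) "SRSeed[" S " ; " γ "]" =>
  (∃ (X₀ : SchemeOver ℂ) (Z : Scheme.{0}) (i : Z ⟶ X₀.left) (x : complexBetti X₀ (2 * 2))
    (𝒳 B : SchemeOver ℂ) (f : 𝒳 ⟶ B) (s₀ t₁ : ComplexPoints B) (e₀ : X₀ ≅ fiberOver f s₀)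
    (e₁ : S ⊗ S ≅ fiberOver f t₁) (W : complexBetti 𝒳 (2 * 2)),
    IsClosedImmersion i ∧ IsRegularImmersionOfCodim i 2 ∧ AlgebraicGeometry.IsIntegral Z ∧
    (∀ z ∈ Set.range i.base, (2 : ℕ∞) ≤ Order.coheight z) ∧ IsBlochSemiregular i 4 2 ∧
    x ∈ classesSupportedOn X₀ (Set.range i.base) (2 * 2) ∧
    IsSmoothProjectiveFamily f 4 ∧ IsQuasiProjectiveOver 𝒳 ∧ IsQuasiProjectiveOver B ∧
    AlgebraicGeometry.Smooth B.hom ∧ ConnectedSpace (ComplexPoints B) ∧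
    (∀ s : ComplexPoints B, IsRationalClass (Res[f, s, 2 * 2, W]) ∧
      IsOfHodgeType 4 (fiberOver f s) (2 * 2) 2 2 (Res[f, s, 2 * 2, W])) ∧
    complexBetti.map e₀.hom (2 * 2) (Res[f, s₀, 2 * 2, W]) = x ∧
    complexBetti.map e₁.hom (2 * 2) (Res[f, t₁, 2 * 2, W]) - γ ∈ algebraicClasses (S ⊗ S) 2)

/-- `Transc[S, y]`: `y` is cup-orthogonal to `N¹(S)` (VERBATIM `…KugaSatakeResidue`). Local notation only. -/
local notation3 (prettyPrint := false) "Transc[" S ", " y "]" =>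
  (∀ d ∈ algebraicClasses S 1, cupProduct (rfl : 2 * 1 + 2 * 1 = 2 * 2) y d = 0)

/-- `Scalar[S]`: «`End_Hdg T(S) = ℚ`» (VERBATIM `…KugaSatakeResidue`). Local notation only. -/
local notation3 (prettyPrint := false) "Scalar[" S "]" =>
  (∀ (f : complexBetti S (2 * 1) →ₗ[ℂ] complexBetti S (2 * 1)),
    (∀ y, IsRationalClass y → IsRationalClass (f y)) →
    (∀ (i j : ℕ) y, IsOfHodgeType 2 S (2 * 1) i j y → IsOfHodgeType 2 S (2 * 1) i j (f y)) →
    (∀ d ∈ algebraicClasses S 1, f d = 0) →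
    (∀ y : complexBetti S (2 * 1), ∀ d ∈ algebraicClasses S 1,
      cupProduct (rfl : 2 * 1 + 2 * 1 = 2 * 2) (f y) d = 0) →
    ∃ a : ℚ, ∀ y : complexBetti S (2 * 1),
      (∀ d ∈ algebraicClasses S 1, cupProduct (rfl : 2 * 1 + 2 * 1 = 2 * 2) y d = 0) →
        f y = (a : ℂ) • y)

/-- `QuadGen[S]`: a real-quadratic generator (VERBATIM `…KugaSatakeResidue`). Local notation only. -/
local notation3 (prettyPrint := false) "QuadGen[" S "]" =>
  (∃ (ψ : complexBetti S (2 * 1) →ₗ[ℂ] complexBetti S (2 * 1)) (d : ℚ), d ≠ 0 ∧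
    (∀ y, IsRationalClass y → IsRationalClass (ψ y)) ∧
    (∀ (i j : ℕ) y, IsOfHodgeType 2 S (2 * 1) i j y → IsOfHodgeType 2 S (2 * 1) i j (ψ y)) ∧
    (∀ d' ∈ algebraicClasses S 1, ψ d' = 0) ∧
    (∀ y : complexBetti S (2 * 1), Transc[S, ψ y]) ∧
    (∀ y w : complexBetti S (2 * 1),
      cupProduct (rfl : 2 * 1 + 2 * 1 = 2 * 2) (ψ y) w = cupProduct (rfl : 2 * 1 + 2 * 1 = 2 * 2) y (ψ w)) ∧
    (∀ y : complexBetti S (2 * 1), Transc[S, y] → ψ (ψ y) = (d : ℂ) • y) ∧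
    TranscendentalEndomorphismsGeneratedBy S ψ)

/-- `GenCycle[S, hS]` (VERBATIM `…KugaSatakeResidue`): ONE cycle-induced rational Hodge endomorphism GENERATING
`End_Hdg T(S)`. Local notation only. -/
local notation3 (prettyPrint := false) "GenCycle[" S ", " hS "]" =>
  (∃ e : complexBetti S (2 * 1) →ₗ[ℂ] complexBetti S (2 * 1),
    (∀ y, IsRationalClass y → IsRationalClass (e y)) ∧
    (∀ (i j : ℕ) y, IsOfHodgeType 2 S (2 * 1) i j y → IsOfHodgeType 2 S (2 * 1) i j (e y)) ∧
    (∃ γ ∈ algebraicClasses (S ⊗ S) 2, ∀ y : complexBetti S (2 * 1),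
      e y = Corr[IsK3Surface.isSmoothProjective hS ; γ, y]) ∧
    TranscendentalEndomorphismsGeneratedBy S e)

/-- `IrrCycle[S, hS]` (VERBATIM `…KugaSatakeResidue`): ONE cycle-induced rational Hodge endomorphism with a
non-rational eigenvalue on a non-zero `(2,0)`-class. Local notation only. -/
local notation3 (prettyPrint := false) "IrrCycle[" S ", " hS "]" =>
  (∃ e : complexBetti S (2 * 1) →ₗ[ℂ] complexBetti S (2 * 1),
    (∀ y, IsRationalClass y → IsRationalClass (e y)) ∧
    (∀ (i j : ℕ) y, IsOfHodgeType 2 S (2 * 1) i j y → IsOfHodgeType 2 S (2 * 1) i j (e y)) ∧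
    (∃ γ ∈ algebraicClasses (S ⊗ S) 2, ∀ y : complexBetti S (2 * 1),
      e y = Corr[IsK3Surface.isSmoothProjective hS ; γ, y]) ∧
    (∃ (σ₀ : complexBetti S (2 * 1)) (ev : ℂ), IsOfHodgeType 2 S (2 * 1) 2 0 σ₀ ∧ σ₀ ≠ 0 ∧
      e σ₀ = ev • σ₀ ∧ ∀ a : ℚ, (a : ℂ) ≠ ev))

/-- `GenSeed[S, hS]`: the SEEDED generation clause — a rational, type-preserving endomorphism `e = [γ]_*` of
`H²(S(ℂ); ℂ)` GENERATING `End_Hdg T(S)`, the class `γ` carrying a semiregular seed package. Local notation only. -/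
local notation3 (prettyPrint := false) "GenSeed[" S ", " hS "]" =>
  (∃ (e : complexBetti S (2 * 1) →ₗ[ℂ] complexBetti S (2 * 1)) (γ : complexBetti (S ⊗ S) (2 * 2)),
    (∀ y, IsRationalClass y → IsRationalClass (e y)) ∧
    (∀ (i j : ℕ) y, IsOfHodgeType 2 S (2 * 1) i j y → IsOfHodgeType 2 S (2 * 1) i j (e y)) ∧
    (∀ y : complexBetti S (2 * 1), e y = Corr[IsK3Surface.isSmoothProjective hS ; γ, y]) ∧
    SRSeed[S ; γ] ∧ TranscendentalEndomorphismsGeneratedBy S e)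

/-- `IrrSeed[S, hS]`: the SEEDED one-cycle clause — a rational, type-preserving `e = [γ]_*` with a non-rational
eigenvalue on a non-zero `(2,0)`-class, the class `γ` carrying a semiregular seed package. Local notation only. -/
local notation3 (prettyPrint := false) "IrrSeed[" S ", " hS "]" =>
  (∃ (e : complexBetti S (2 * 1) →ₗ[ℂ] complexBetti S (2 * 1)) (γ : complexBetti (S ⊗ S) (2 * 2)),
    (∀ y, IsRationalClass y → IsRationalClass (e y)) ∧
    (∀ (i j : ℕ) y, IsOfHodgeType 2 S (2 * 1) i j y → IsOfHodgeType 2 S (2 * 1) i j (e y)) ∧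
    (∀ y : complexBetti S (2 * 1), e y = Corr[IsK3Surface.isSmoothProjective hS ; γ, y]) ∧
    SRSeed[S ; γ] ∧
    (∃ (σ₀ : complexBetti S (2 * 1)) (ev : ℂ), IsOfHodgeType 2 S (2 * 1) 2 0 σ₀ ∧ σ₀ ≠ 0 ∧
      e σ₀ = ev • σ₀ ∧ ∀ a : ℚ, (a : ℂ) ≠ ev))

/-! ### §1 The seed entry: a class on `S × S` detected by a semiregular seed in a connected family is algebraic -/

/-- **(K3-SR, step A) A class on `S × S` congruent modulo `A²(S ⊗ S)` to the fibre value of a global class that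
is supported on a Bloch-semiregular integral lci surface in SOME fibre of a connected smooth projective family
of fourfolds through `S × S` is algebraic**: Bloch spread near the seed fibre (`BlochSemiregularSpread 4 2`),
Baire spread to the whole connected base (`algebraicLocusClosed`, Charles–Schnell), transport along
`e₁ : S ⊗ S ≅ 𝒳_{t₁}` (`map_mem_algebraicClasses_of_isIso`). The K3-square twin of T3A; modulo
{Bloch 1972 ∕ Buchweitz–Flenner 2003 Thm. 5.2}. [cite: BuchweitzFlenner2003, Thm. 5.2]
[cite: CharlesSchnell2014Notes, Prop. 11.3.11 (proof)] [cite: VoisinHodgeII2003, §7.3.2] -/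
theorem mem_algebraicClasses_of_semiregularSeed (hBl : BlochSemiregularSpread 4 2)
    (γ : complexBetti (S ⊗ S) (2 * 2))
    (X₀ : SchemeOver ℂ) (Z : Scheme.{0}) (i : Z ⟶ X₀.left) (x : complexBetti X₀ (2 * 2))
    (𝒳 B : SchemeOver ℂ) (f : 𝒳 ⟶ B) (s₀ t₁ : ComplexPoints B) (e₀ : X₀ ≅ fiberOver f s₀)
    (e₁ : S ⊗ S ≅ fiberOver f t₁) (W : complexBetti 𝒳 (2 * 2))
    (hi : IsClosedImmersion i) (hreg : IsRegularImmersionOfCodim i 2) (hZ : AlgebraicGeometry.IsIntegral Z)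
    (hcoh : ∀ z ∈ Set.range i.base, (2 : ℕ∞) ≤ Order.coheight z)
    (hsr : IsBlochSemiregular i 4 2)
    (hx : x ∈ classesSupportedOn X₀ (Set.range i.base) (2 * 2))
    (hf : IsSmoothProjectiveFamily f 4) (h𝒳 : IsQuasiProjectiveOver 𝒳) (hB : IsQuasiProjectiveOver B)
    (hBsm : AlgebraicGeometry.Smooth B.hom) (hconn : ConnectedSpace (ComplexPoints B))
    (hW : ∀ s : ComplexPoints B, IsRationalClass (Res[f, s, 2 * 2, W]) ∧
      IsOfHodgeType 4 (fiberOver f s) (2 * 2) 2 2 (Res[f, s, 2 * 2, W]))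
    (hWx : complexBetti.map e₀.hom (2 * 2) (Res[f, s₀, 2 * 2, W]) = x)
    (hWγ : complexBetti.map e₁.hom (2 * 2) (Res[f, t₁, 2 * 2, W]) - γ ∈ algebraicClasses (S ⊗ S) 2) :
    γ ∈ algebraicClasses (S ⊗ S) 2 := by
  obtain ⟨U, hU, hs₀, hUalg⟩ :=
    hBl X₀ Z i x 𝒳 B f s₀ e₀ W hi hreg hZ hcoh hsr hx hf h𝒳 hB hBsm hW hWx
  have halg := algebraicLocusClosed 𝒳 B f 4 2 W hf h𝒳 hB hBsm hconn U hU ⟨s₀, hs₀⟩ hUalg t₁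
  have h' := map_mem_algebraicClasses_of_isIso e₁.hom halg
  have := sub_mem h' hWγ
  rwa [sub_sub_cancel] at this

/-- **The packaged form**: `SRSeed[S ; γ] ⟹ γ ∈ A²(S ⊗ S)`, modulo {Bloch∕Buchweitz–Flenner}.
[cite: BuchweitzFlenner2003, Thm. 5.2] [cite: CharlesSchnell2014Notes, Prop. 11.3.11 (proof)] -/
theorem mem_algebraicClasses_of_srSeed (hBl : BlochSemiregularSpread 4 2) {γ : complexBetti (S ⊗ S) (2 * 2)}
    (h : SRSeed[S ; γ]) : γ ∈ algebraicClasses (S ⊗ S) 2 := by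
  obtain ⟨X₀, Z, i, x, 𝒳, B, f, s₀, t₁, e₀, e₁, W, hi, hreg, hZ, hcoh, hsr, hx, hf, h𝒳, hB, hBsm, hconn, hW,
    hWx, hWγ⟩ := h
  exact mem_algebraicClasses_of_semiregularSeed hBl γ X₀ Z i x 𝒳 B f s₀ t₁ e₀ e₁ W hi hreg hZ hcoh hsr hx hf h𝒳
    hB hBsm hconn hW hWx hWγ

/-! ### §2 Cycle-induced endomorphisms and HC⁴(S × S) from a semiregular seed -/

/-- **(K3-SR) An admissible transcendental endomorphism induced by a seeded class is cycle-induced**: for a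
smooth projective surface `S` and `t = [γ]_*` rational, type-preserving, killing `N¹(S)` with image cup-orthogonal
to `N¹(S)`, a semiregular seed package for `γ` makes `γ` algebraic (§1), so `t` is
`IsCycleInducedTranscendentalEndomorphism`. Modulo {Bloch∕Buchweitz–Flenner}; CONDITIONAL on the seed.
[cite: BuchweitzFlenner2003, Thm. 5.2] [cite: GeemenSchutt2023, §4.8] -/
theorem isCycleInducedTranscendentalEndomorphism_of_semiregularSeed (hBl : BlochSemiregularSpread 4 2)
    (hS : IsSmoothProjective 2 S) (t : complexBetti S (2 * 1) →ₗ[ℂ] complexBetti S (2 * 1))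
    (ht_rat : ∀ y, IsRationalClass y → IsRationalClass (t y))
    (ht_typ : ∀ (i j : ℕ) (y : complexBetti S (2 * 1)),
      IsOfHodgeType 2 S (2 * 1) i j y → IsOfHodgeType 2 S (2 * 1) i j (t y))
    (ht_N : ∀ d ∈ algebraicClasses S 1, t d = 0)
    (ht_perp : ∀ y : complexBetti S (2 * 1), Transc[S, t y])
    {γ : complexBetti (S ⊗ S) (2 * 2)} (hγt : ∀ y : complexBetti S (2 * 1), t y = Corr[hS ; γ, y])
    (hseed : SRSeed[S ; γ]) :
    IsCycleInducedTranscendentalEndomorphism S hS t :=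
  ⟨ht_rat, ht_typ, ht_N, ht_perp, γ, mem_algebraicClasses_of_srSeed hBl hseed, hγt⟩

/-- **(K3-SR) HC⁴(S × S) from a seeded generator**: for a smooth projective surface `S` and a rational
endomorphism `t = [γ]_*` of `H²(S(ℂ); ℂ)` killing `N¹(S)` and GENERATING the rational Hodge endomorphisms of
`T(S)` (`TranscendentalEndomorphismsGeneratedBy S t`), a semiregular seed package for `γ` gives
`HodgeConjectureFor 4 (S ⊗ S)` — §1 makes `γ` algebraic and the rung F4 `SquareOfGenerator.squareOfGenerator`
(Varesco's bookkeeping over `ℚ[t]`) concludes. The semiregular-seed form of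
`AlgebraicLocusSpread.hodgeConjectureFor_square_of_spreadFamily`. Modulo {Bloch∕Buchweitz–Flenner}; CONDITIONAL on
the seed; credits nothing to HC. [cite: BuchweitzFlenner2003, Thm. 5.2] [cite: Varesco2023, §2 (p. 8)]
[cite: GeemenSchutt2023, §3 and §4.8] -/
theorem hodgeConjectureFor_square_of_semiregularSeed (hBl : BlochSemiregularSpread 4 2)
    (hS : IsSmoothProjective 2 S) (t : complexBetti S (2 * 1) →ₗ[ℂ] complexBetti S (2 * 1))
    (ht_rat : ∀ y, IsRationalClass y → IsRationalClass (t y))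
    (ht_N : ∀ d ∈ algebraicClasses S 1, t d = 0)
    (hgen : TranscendentalEndomorphismsGeneratedBy S t)
    {γ : complexBetti (S ⊗ S) (2 * 2)} (hγt : ∀ y : complexBetti S (2 * 1), t y = Corr[hS ; γ, y])
    (hseed : SRSeed[S ; γ]) :
    HodgeConjectureFor 4 (S ⊗ S) :=
  SquareOfGenerator.squareOfGenerator S hS t ht_rat ht_N ⟨γ, mem_algebraicClasses_of_srSeed hBl hseed, hγt⟩ hgen

/-! ### §3 The socket: the residue of the crux with semiregular seeds as the one geometric input -/

/-- **Seeded generation ⟹ (GEN)**: `GenSeed[S, hS] → GenCycle[S, hS]` (§1 on the class `γ`).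
[cite: BuchweitzFlenner2003, Thm. 5.2] [cite: GeemenSchutt2023, §4.8] -/
theorem genCycle_of_semiregularSeed (hBl : BlochSemiregularSpread 4 2) (hS : IsK3Surface S)
    (h : GenSeed[S, hS]) : GenCycle[S, hS] := by
  obtain ⟨e, γ, hrat, htyp, hγe, hseed, hgen⟩ := h
  exact ⟨e, hrat, htyp, ⟨γ, mem_algebraicClasses_of_srSeed hBl hseed, hγe⟩, hgen⟩

/-- **Seeded one-cycle ⟹ (ONE)**: `IrrSeed[S, hS] → IrrCycle[S, hS]` (§1 on the class `γ`).
[cite: BuchweitzFlenner2003, Thm. 5.2] [cite: GeemenSchutt2023, §4.8] -/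
theorem irrCycle_of_semiregularSeed (hBl : BlochSemiregularSpread 4 2) (hS : IsK3Surface S)
    (h : IrrSeed[S, hS]) : IrrCycle[S, hS] := by
  obtain ⟨e, γ, hrat, htyp, hγe, hseed, hev⟩ := h
  exact ⟨e, hrat, htyp, ⟨γ, mem_algebraicClasses_of_srSeed hBl hseed, hγe⟩, hev⟩

/-- **`PicardThreeK3Squares` BY NAME with SEMIREGULAR SEEDS as the one geometric input (the K3-side socket of
chapter ROUTE-P1AL).** Granted Buskin's Thm. 1.1, markings, Varesco's Thm. 5.3 and the Kuga–Satake statement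
for the non-CM projective K3 surfaces with `3 ≤ ρ(S) ≤ 16` and a real-quadratic generator (as in p640321's
`picardThreeK3Squares_of_kugaSatake_of_generation_and_oneCycle`), and Bloch's semiregularity theorem
(`BlochSemiregularSpread 4 2`), the crux follows from: (GEN-SR) on the non-CM, non-scalar surfaces without
real-quadratic generator at `ρ(S) ∈ {4, 6, 10}`, a rational type-preserving `e = [γ]_*` GENERATING
`End_Hdg T(S)` with a SEMIREGULAR SEED PACKAGE for `γ` (`GenSeed`); (ONE-SR) on those at `ρ(S) ∈ {7, 13}`, a
rational type-preserving `e = [γ]_*` with a non-rational `(2,0)`-eigenvalue and a semiregular seed package for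
`γ` (`IrrSeed`). CONDITIONAL (Kuga–Satake open in print; no seed in print); credits nothing to HC; the open
core of the crux is unchanged — this only types its entry. [cite: BuchweitzFlenner2003, Thm. 5.2]
[cite: GeemenSchutt2023, Thm. 1.1, §4.8 and Rem. 4.9] [cite: Varesco2023, Thm. 5.3] [cite: Buskin2019, Thm. 1.1] -/
theorem picardThreeK3Squares_of_kugaSatake_of_semiregularSeeds (hB : Buskin2019_hodgeIsometry_algebraic)
    (hmark : Huybrechts_K3_marking_exists)
    (hVar : Varesco2023_transcendentalHodgeSimilitude_algebraic_of_kugaSatake_K3)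
    (hKS : ∀ (S : SchemeOver ℂ) (hS : IsK3Surface S), ¬ HasComplexMultiplication S →
      3 ≤ Module.finrank ℂ ↥(algebraicClasses S 1) → Module.finrank ℂ ↥(algebraicClasses S 1) ≤ 16 →
      QuadGen[S] → IsKSCorrespondenceAlgebraicBetti hS.isSmoothProjective)
    (hBl : BlochSemiregularSpread 4 2)
    (hGenSR : ∀ (S : SchemeOver ℂ) (hS : IsK3Surface S), ¬ HasComplexMultiplication S →
      (Module.finrank ℂ ↥(algebraicClasses S 1) = 4 ∨ Module.finrank ℂ ↥(algebraicClasses S 1) = 6 ∨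
        Module.finrank ℂ ↥(algebraicClasses S 1) = 10) → ¬ Scalar[S] → ¬ QuadGen[S] → GenSeed[S, hS])
    (hOneSR : ∀ (S : SchemeOver ℂ) (hS : IsK3Surface S), ¬ HasComplexMultiplication S →
      (Module.finrank ℂ ↥(algebraicClasses S 1) = 7 ∨ Module.finrank ℂ ↥(algebraicClasses S 1) = 13) →
      ¬ Scalar[S] → ¬ QuadGen[S] → IrrSeed[S, hS]) :
    PicardThreeK3Squares :=
  picardThreeK3Squares_of_kugaSatake_of_generation_and_oneCycle hB hmark hVar hKS
    (fun S hS hCM hρ hsc hq ↦ genCycle_of_semiregularSeed hBl hS (hGenSR S hS hCM hρ hsc hq))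
    (fun S hS hCM hρ hsc hq ↦ irrCycle_of_semiregularSeed hBl hS (hOneSR S hS hCM hρ hsc hq))

end Summit.HodgeConjecture.HodgeConjecture.Theorems.MarkmanPartnerTransport.SemiregularSeed

end
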